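import Summits.QuantumFields.YangMills.Theses.ThermodynamicCeilings
import Summits.QuantumFields.YangMills.Theorems.AntiScreeningCeilingsAbelTransfer

/-!
# Route `ThermodynamicCeilings` — LINE F support item `AbelWindowTransferW` (stmt-QuantumFields-27777): PROVED

D-0145 ideator seat ym-idea-11 (generation g5, lens «wuc»).  Pure real analysis behind the WINDOWED spectral split of
K_M (`ScaleMonotonicityC`): for a finite positive measure `ν` on `(0,∞)` whose cumulative weight obeys the degree-8 doubling
bound ONLY ON THE WINDOW `E₀ ≤ x ≤ λx ≤ 1` (`E₀ ≤ 1`) together with ONE Laplace-weighted UV bound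
`∫_{E ≥ 1} e^{-2E} dν ≤ A·ν([0,1))`, the symmetrised Laplace transform `F(t) = κ₀ + ∫ (e^{-Et} + e^{-E(T-t)}) dν` still satisfies
`t⁸ F(t) ≤ A' t₂⁸ F(t₂)` for `2 ≤ t ≤ t₂`, `2t₂ ≤ T`, `t₂E₀ ≤ 4`, with `A' = A(1+e⁴) + A²·8⁸·e⁶ + 1`.

Proof: split `ν = ν|_{[0,1)} + ν|_{[1,∞)}`.  The window part `ν|_{[0,1)}` satisfies the UNRESTRICTED doubling hypothesis of
the landed `Spectral.abelWindowTransfer_core` (above `1` its cumulative weight is constant; a dilation crossing `1` is dominated by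
the dilation `λ' = 1/x ≤ λ` landing exactly at `1`), so that lemma applies verbatim.  On the UV part, for `E ≥ 1`, `t ≥ 2`:
`e^{-Et} ≤ e^{-(t-2)} e^{-2E}`, so `∫ e^{-Et} dν|_{[1,∞)} ≤ e^{-(t-2)} A ν([0,1))`, and `ν([0,1)) ≤ A e⁴ t₂⁸ ∫ e^{-Et₂} dν`
(window doubling from `x = 4/t₂ ≥ E₀` when `t₂ > 4`, nothing when `t₂ ≤ 4`), while `t⁸ e^{-(t-2)} ≤ 8⁸ e²`; the increasing part
`e^{-E(T-t)}` is monotone in `t`.  Mathlib + the landed Abel-transfer lemmas only; closes ONLY the support item 27777; no crux,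
leaf, NT, UV-stability or IR statement is proved.
-/

namespace Summit.QuantumFields.YangMills.Cruxes.ScaleMonotonicity.SpectralW

open MeasureTheory Set
open Summit.QuantumFields.YangMills.Cruxes.ScaleMonotonicity.Spectral (exp_integrable abelWindowTransfer_core)

/-- restriction preserves the support condition `ν((-∞,0]) = 0`. -/
theorem restrict_Iic_zero (ν : Measure ℝ) (hsupp : ν (Iic 0) = 0) (s : Set ℝ) :
    (ν.restrict s) (Iic 0) = 0 :=
  le_antisymm ((Measure.le_iff'.1 Measure.restrict_le_self (Iic 0)).trans_eq hsupp) bot_le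

/-- WINDOW ⇒ FULL doubling for the restriction to `[0,1)`. -/
theorem doubling_restrict (ν : Measure ℝ) [IsFiniteMeasure ν] (A E₀ : ℝ) (hA : 1 ≤ A)
    (hwin : ∀ lam x : ℝ, 1 ≤ lam → E₀ ≤ x → lam * x ≤ 1 →
      (ν (Iio (lam * x))).toReal ≤ A * lam ^ 8 * (ν (Iio x)).toReal) :
    ∀ lam x : ℝ, 1 ≤ lam → E₀ ≤ x →
      ((ν.restrict (Iio 1)) (Iio (lam * x))).toReal ≤ A * lam ^ 8 * ((ν.restrict (Iio 1)) (Iio x)).toReal := by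
  intro lam x hl hx
  have hl0 : 0 < lam := by linarith
  have hres : ∀ y : ℝ, (ν.restrict (Iio 1)) (Iio y) = ν (Iio (min y 1)) := fun y => by
    rw [Measure.restrict_apply measurableSet_Iio, Iio_inter_Iio]
  rw [hres, hres]
  have hl8 : 1 ≤ lam ^ 8 := one_le_pow₀ hl
  have hAl : 1 ≤ A * lam ^ 8 := by nlinarith
  by_cases hx1 : 1 ≤ x
  · have h1 : min (lam * x) 1 = 1 := min_eq_right (by nlinarith)
    have h2 : min x 1 = 1 := min_eq_right hx1
    rw [h1, h2]
    exact le_mul_of_one_le_left ENNReal.toReal_nonneg hAl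
  · push Not at hx1
    rw [min_eq_left hx1.le]
    by_cases hlx : lam * x ≤ 1
    · rw [min_eq_left hlx]; exact hwin lam x hl hx hlx
    · push Not at hlx
      rw [min_eq_right hlx.le]
      have hx0 : 0 < x := by
        by_contra h
        push Not at h
        nlinarith
      have hl' : 1 ≤ 1 / x := by rw [le_div_iff₀ hx0]; linarith
      have hl'x : 1 / x * x = 1 := by field_simp
      have hle : 1 / x ≤ lam := by rw [div_le_iff₀ hx0]; linarith
      have hl'0 : 0 ≤ 1 / x := by positivity
      have h := hwin (1 / x) x hl' hx hl'x.le
      rw [hl'x] at h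
      calc (ν (Iio 1)).toReal ≤ A * (1 / x) ^ 8 * (ν (Iio x)).toReal := h
        _ ≤ A * lam ^ 8 * (ν (Iio x)).toReal := by
          have hA0 : 0 ≤ A := by linarith
          have hp : (1 / x) ^ 8 ≤ lam ^ 8 := pow_le_pow_left₀ hl'0 hle 8
          have hm : 0 ≤ (ν (Iio x)).toReal := ENNReal.toReal_nonneg
          have := mul_le_mul_of_nonneg_left hp hA0
          exact mul_le_mul_of_nonneg_right this hm

/-- the elementary bound `t⁸ e^{-(t-2)} ≤ 8⁸ e²` (`t ≥ 0`). -/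
theorem pow_eight_exp_le (t : ℝ) (ht : 0 ≤ t) : t ^ 8 * Real.exp (-(t - 2)) ≤ 8 ^ 8 * Real.exp 2 := by
  have h1 : t / 8 ≤ Real.exp (t / 8) := by linarith [Real.add_one_le_exp (t / 8)]
  have h2 : t ≤ 8 * Real.exp (t / 8) := by linarith
  have h3 : t ^ 8 ≤ (8 * Real.exp (t / 8)) ^ 8 := pow_le_pow_left₀ ht h2 8
  have h4 : (8 * Real.exp (t / 8)) ^ 8 = 8 ^ 8 * Real.exp t := by
    rw [mul_pow, ← Real.exp_nat_mul]; congr 1; congr 1; push_cast; ring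
  have h5 : Real.exp (-(t - 2)) = Real.exp 2 * Real.exp (-t) := by rw [← Real.exp_add]; congr 1; ring
  have h6 : Real.exp t * Real.exp (-t) = 1 := by rw [← Real.exp_add, add_neg_cancel, Real.exp_zero]
  calc t ^ 8 * Real.exp (-(t - 2)) ≤ 8 ^ 8 * Real.exp t * Real.exp (-(t - 2)) :=
        mul_le_mul_of_nonneg_right (h3.trans_eq h4) (Real.exp_pos _).le
    _ = 8 ^ 8 * Real.exp 2 * (Real.exp t * Real.exp (-t)) := by rw [h5]; ring
    _ = 8 ^ 8 * Real.exp 2 := by rw [h6, mul_one]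

/-- the UV anchor: `ν([0,1)) ≤ A e⁴ t₂⁸ ∫ e^{-Et₂} dν` for `2 ≤ t₂`, `t₂E₀ ≤ 4`, from window doubling at `x = 4/t₂`. -/
theorem cum_one_le (ν : Measure ℝ) [IsFiniteMeasure ν] (hsupp : ν (Iic 0) = 0) (A E₀ : ℝ) (hA : 1 ≤ A)
    (hwin : ∀ lam x : ℝ, 1 ≤ lam → E₀ ≤ x → lam * x ≤ 1 →
      (ν (Iio (lam * x))).toReal ≤ A * lam ^ 8 * (ν (Iio x)).toReal)
    {t₂ : ℝ} (ht₂ : 2 ≤ t₂) (hwin4 : t₂ * E₀ ≤ 4) :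
    (ν (Iio 1)).toReal ≤ A * Real.exp 4 * t₂ ^ 8 * ∫ E, Real.exp (-(E * t₂)) ∂ν := by
  have ht₂0 : 0 < t₂ := by linarith
  have hI := exp_integrable ν hsupp t₂ ht₂0.le
  -- lower bound of the Laplace transform by the mass below a level `y ≤ 4/t₂`
  have hlow : ∀ y : ℝ, y * t₂ ≤ 4 → Real.exp (-4) * (ν (Iio y)).toReal ≤ ∫ E, Real.exp (-(E * t₂)) ∂ν := by
    intro y hy
    have h1 : ∫ E in Iio y, Real.exp (-4) ∂ν ≤ ∫ E in Iio y, Real.exp (-(E * t₂)) ∂ν := by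
      refine setIntegral_mono_on (integrable_const _).integrableOn hI.integrableOn measurableSet_Iio ?_
      intro E hE
      apply Real.exp_le_exp.mpr
      have : E * t₂ ≤ y * t₂ := mul_le_mul_of_nonneg_right (le_of_lt hE) ht₂0.le
      linarith
    have h2 : ∫ E in Iio y, Real.exp (-(E * t₂)) ∂ν ≤ ∫ E, Real.exp (-(E * t₂)) ∂ν :=
      setIntegral_le_integral hI (Filter.Eventually.of_forall fun E => (Real.exp_pos _).le)
    have h3 : ∫ E in Iio y, Real.exp (-4) ∂ν = Real.exp (-4) * (ν (Iio y)).toReal := by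
      rw [setIntegral_const, smul_eq_mul, mul_comm]; rfl
    linarith [h3.symm.le]
  have he : Real.exp 4 * Real.exp (-4) = 1 := by rw [← Real.exp_add]; norm_num
  have hF0 : 0 ≤ ∫ E, Real.exp (-(E * t₂)) ∂ν := integral_nonneg fun E => (Real.exp_pos _).le
  have ht8 : 1 ≤ t₂ ^ 8 := one_le_pow₀ (by linarith)
  rcases le_or_gt t₂ 4 with h4 | h4
  · -- no doubling needed: `t₂ ≤ 4`
    have h := hlow 1 (by linarith)
    have hm : (ν (Iio 1)).toReal ≤ Real.exp 4 * ∫ E, Real.exp (-(E * t₂)) ∂ν := by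
      have := mul_le_mul_of_nonneg_left h (Real.exp_pos 4).le
      rw [← mul_assoc, he, one_mul] at this
      exact this
    calc (ν (Iio 1)).toReal ≤ Real.exp 4 * ∫ E, Real.exp (-(E * t₂)) ∂ν := hm
      _ ≤ A * Real.exp 4 * t₂ ^ 8 * ∫ E, Real.exp (-(E * t₂)) ∂ν := by
        have h0 : 0 ≤ Real.exp 4 * ∫ E, Real.exp (-(E * t₂)) ∂ν := by positivity
        have hAt : 1 ≤ A * t₂ ^ 8 := by nlinarith
        calc Real.exp 4 * ∫ E, Real.exp (-(E * t₂)) ∂ν = 1 * (Real.exp 4 * ∫ E, Real.exp (-(E * t₂)) ∂ν) := (one_mul _).symm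
          _ ≤ (A * t₂ ^ 8) * (Real.exp 4 * ∫ E, Real.exp (-(E * t₂)) ∂ν) := mul_le_mul_of_nonneg_right hAt h0
          _ = _ := by ring
  · -- doubling from `x = 4/t₂` (`≥ E₀`, `< 1`) with `λ = t₂/4`
    have hx : E₀ ≤ 4 / t₂ := by rw [le_div_iff₀ ht₂0]; linarith
    have hl : 1 ≤ t₂ / 4 := by rw [le_div_iff₀ (by norm_num : (0:ℝ) < 4)]; linarith
    have hlx : t₂ / 4 * (4 / t₂) = 1 := by field_simp
    have hd := hwin (t₂ / 4) (4 / t₂) hl hx hlx.le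
    rw [hlx] at hd
    have h := hlow (4 / t₂) (by rw [div_mul_cancel₀ _ ht₂0.ne'])
    have hl0 : 0 ≤ t₂ / 4 := by positivity
    have hp : (t₂ / 4) ^ 8 ≤ t₂ ^ 8 := pow_le_pow_left₀ hl0 (by linarith) 8
    have hA0 : 0 ≤ A := by linarith
    calc (ν (Iio 1)).toReal ≤ A * (t₂ / 4) ^ 8 * (ν (Iio (4 / t₂))).toReal := hd
      _ = A * (t₂ / 4) ^ 8 * (Real.exp 4 * (Real.exp (-4) * (ν (Iio (4 / t₂))).toReal)) := by
          rw [← mul_assoc (Real.exp 4), he, one_mul]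
      _ ≤ A * (t₂ / 4) ^ 8 * (Real.exp 4 * ∫ E, Real.exp (-(E * t₂)) ∂ν) := by
          have : Real.exp 4 * (Real.exp (-4) * (ν (Iio (4 / t₂))).toReal) ≤ Real.exp 4 * ∫ E, Real.exp (-(E * t₂)) ∂ν :=
            mul_le_mul_of_nonneg_left h (Real.exp_pos 4).le
          exact mul_le_mul_of_nonneg_left this (by positivity)
      _ ≤ A * t₂ ^ 8 * (Real.exp 4 * ∫ E, Real.exp (-(E * t₂)) ∂ν) := by
          have h0 : 0 ≤ Real.exp 4 * ∫ E, Real.exp (-(E * t₂)) ∂ν := by positivity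
          exact mul_le_mul_of_nonneg_right (mul_le_mul_of_nonneg_left hp hA0) h0
      _ = A * Real.exp 4 * t₂ ^ 8 * ∫ E, Real.exp (-(E * t₂)) ∂ν := by ring

/-- **AbelWindowTransferW (core form).**  The route's support item with its hypotheses as arguments and the explicit
constant `A' = A(1+e⁴) + A²·8⁸·e⁶ + 1`. -/
theorem abelWindowTransferW_core (ν : Measure ℝ) (κ₀ A E₀ T : ℝ) (hfin : IsFiniteMeasure ν)
    (hsupp : ν (Iic 0) = 0) (hκ₀ : 0 ≤ κ₀) (hA : 1 ≤ A) (hE₀ : 0 < E₀) (_hE₀1 : E₀ ≤ 1)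
    (hwin : ∀ lam x : ℝ, 1 ≤ lam → E₀ ≤ x → lam * x ≤ 1 →
      (ν (Iio (lam * x))).toReal ≤ A * lam ^ 8 * (ν (Iio x)).toReal)
    (huv : (∫ E in Ici (1 : ℝ), Real.exp (-(2 * E)) ∂ν) ≤ A * (ν (Iio 1)).toReal)
    (t t₂ : ℝ) (ht : 2 ≤ t) (htt : t ≤ t₂) (hT : 2 * t₂ ≤ T) (hwin4 : t₂ * E₀ ≤ 4) :
    t ^ 8 * (κ₀ + ∫ E, (Real.exp (-(E * t)) + Real.exp (-(E * (T - t)))) ∂ν) ≤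
      (A * (1 + Real.exp 4) + A ^ 2 * 8 ^ 8 * Real.exp 6 + 1) * t₂ ^ 8 *
        (κ₀ + ∫ E, (Real.exp (-(E * t₂)) + Real.exp (-(E * (T - t₂)))) ∂ν) := by
  haveI := hfin
  have ht0 : 0 < t := by linarith
  have ht₂ : 2 ≤ t₂ := le_trans ht htt
  have ht₂0 : 0 < t₂ := by linarith
  set ν₁ : Measure ℝ := ν.restrict (Iio 1) with hν₁
  set ν₂ : Measure ℝ := ν.restrict (Ici 1) with hν₂
  have hsupp₁ : ν₁ (Iic 0) = 0 := restrict_Iic_zero ν hsupp _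
  have hsupp₂ : ν₂ (Iic 0) = 0 := restrict_Iic_zero ν hsupp _
  have hsplit : ν₁ + ν₂ = ν := by
    rw [hν₁, hν₂, ← compl_Iio, Measure.restrict_add_restrict_compl measurableSet_Iio]
  -- names for the integrands
  set f : ℝ → ℝ → ℝ := fun τ E => Real.exp (-(E * τ)) with hf
  have hfI : ∀ (μ : Measure ℝ) [IsFiniteMeasure μ], μ (Iic 0) = 0 → ∀ τ : ℝ, 0 ≤ τ → Integrable (f τ) μ :=
    fun μ _ h τ hτ => exp_integrable μ h τ hτ
  have hf0 : ∀ τ E, 0 ≤ f τ E := fun τ E => (Real.exp_pos _).le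
  -- the three measures integrate all `f τ`, `τ ≥ 0`
  have hsumI : ∀ (μ : Measure ℝ) [IsFiniteMeasure μ], μ (Iic 0) = 0 → ∀ τ σ : ℝ, 0 ≤ τ → 0 ≤ σ →
      Integrable (fun E => f τ E + f σ E) μ := fun μ _ h τ σ hτ hσ => (hfI μ h τ hτ).add (hfI μ h σ hσ)
  -- split of the combined integrals along `ν = ν₁ + ν₂`
  have hcomb : ∀ τ σ : ℝ, 0 ≤ τ → 0 ≤ σ →
      ∫ E, (f τ E + f σ E) ∂ν = ∫ E, (f τ E + f σ E) ∂ν₁ + ∫ E, (f τ E + f σ E) ∂ν₂ := by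
    intro τ σ hτ hσ
    conv_lhs => rw [← hsplit]
    exact integral_add_measure (hsumI ν₁ hsupp₁ τ σ hτ hσ) (hsumI ν₂ hsupp₂ τ σ hτ hσ)
  have hTt : 0 ≤ T - t := by linarith
  have hTt₂ : 0 ≤ T - t₂ := by linarith
  -- (1) the window part: the landed core lemma for `ν₁`
  have h1 := abelWindowTransfer_core ν₁ κ₀ A E₀ T inferInstance hsupp₁ hκ₀ hA hE₀
    (doubling_restrict ν A E₀ hA hwin) t t₂ (by linarith) htt hT hwin4
  -- (2) the UV decreasing part
  have hae₂ : ∀ᵐ E ∂ν₂, (1 : ℝ) ≤ E := by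
    rw [hν₂]; exact (ae_restrict_mem measurableSet_Ici)
  have h2a : ∫ E, f t E ∂ν₂ ≤ ∫ E, Real.exp (-(t - 2)) * Real.exp (-(2 * E)) ∂ν₂ := by
    have hI2 : Integrable (fun E => Real.exp (-(2 * E))) ν₂ := by
      have : (fun E : ℝ => Real.exp (-(2 * E))) = f 2 := by funext E; simp only [hf]; ring_nf
      rw [this]; exact hfI ν₂ hsupp₂ 2 (by norm_num)
    refine integral_mono_ae (hfI ν₂ hsupp₂ t ht0.le) (hI2.const_mul _) ?_
    filter_upwards [hae₂] with E hE
    simp only [hf]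
    rw [← Real.exp_add]
    apply Real.exp_le_exp.mpr
    nlinarith
  have h2b : ∫ E, Real.exp (-(t - 2)) * Real.exp (-(2 * E)) ∂ν₂ ≤ Real.exp (-(t - 2)) * (A * (ν (Iio 1)).toReal) := by
    rw [integral_const_mul]
    exact mul_le_mul_of_nonneg_left huv (Real.exp_pos _).le
  have h2c := cum_one_le ν hsupp A E₀ hA hwin ht₂ hwin4
  have h2d := pow_eight_exp_le t ht0.le
  set F₂ := ∫ E, f t₂ E ∂ν with hF₂
  have hF₂0 : 0 ≤ F₂ := integral_nonneg fun E => hf0 t₂ E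
  have h2 : t ^ 8 * ∫ E, f t E ∂ν₂ ≤ A ^ 2 * 8 ^ 8 * Real.exp 6 * t₂ ^ 8 * F₂ := by
    have hm0 : 0 ≤ (ν (Iio 1)).toReal := ENNReal.toReal_nonneg
    have hA0 : 0 ≤ A := by linarith
    have step : ∫ E, f t E ∂ν₂ ≤ Real.exp (-(t - 2)) * (A * (A * Real.exp 4 * t₂ ^ 8 * F₂)) :=
      (h2a.trans h2b).trans (mul_le_mul_of_nonneg_left (mul_le_mul_of_nonneg_left h2c hA0) (Real.exp_pos _).le)
    have he6 : Real.exp 2 * Real.exp 4 = Real.exp 6 := by rw [← Real.exp_add]; norm_num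
    calc t ^ 8 * ∫ E, f t E ∂ν₂ ≤ t ^ 8 * (Real.exp (-(t - 2)) * (A * (A * Real.exp 4 * t₂ ^ 8 * F₂))) :=
          mul_le_mul_of_nonneg_left step (by positivity)
      _ = (t ^ 8 * Real.exp (-(t - 2))) * (A ^ 2 * Real.exp 4 * t₂ ^ 8 * F₂) := by ring
      _ ≤ (8 ^ 8 * Real.exp 2) * (A ^ 2 * Real.exp 4 * t₂ ^ 8 * F₂) :=
          mul_le_mul_of_nonneg_right h2d (by positivity)
      _ = A ^ 2 * 8 ^ 8 * (Real.exp 2 * Real.exp 4) * t₂ ^ 8 * F₂ := by ring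
      _ = A ^ 2 * 8 ^ 8 * Real.exp 6 * t₂ ^ 8 * F₂ := by rw [he6]
  -- (3) the UV increasing part is monotone in `t`
  have hae₂' : ∀ᵐ E ∂ν₂, (0 : ℝ) ≤ E := by filter_upwards [hae₂] with E hE; linarith
  have h3a : ∫ E, f (T - t) E ∂ν₂ ≤ ∫ E, f (T - t₂) E ∂ν₂ := by
    refine integral_mono_ae (hfI ν₂ hsupp₂ _ hTt) (hfI ν₂ hsupp₂ _ hTt₂) ?_
    filter_upwards [hae₂'] with E hE
    simp only [hf]
    apply Real.exp_le_exp.mpr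
    nlinarith
  set G₂ := ∫ E, f (T - t₂) E ∂ν₂ with hG₂
  have hG₂0 : 0 ≤ G₂ := integral_nonneg fun E => hf0 _ E
  have hpow : t ^ 8 ≤ t₂ ^ 8 := pow_le_pow_left₀ ht0.le htt 8
  have h3 : t ^ 8 * ∫ E, f (T - t) E ∂ν₂ ≤ t₂ ^ 8 * G₂ :=
    (mul_le_mul_of_nonneg_left h3a (by positivity)).trans (mul_le_mul_of_nonneg_right hpow hG₂0)
  -- bookkeeping: the pieces versus the full quantity at `t₂`
  set W₁ := ∫ E, (f t₂ E + f (T - t₂) E) ∂ν₁ with hW₁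
  set W₂ := ∫ E, (f t₂ E + f (T - t₂) E) ∂ν₂ with hW₂
  have hW₁0 : 0 ≤ W₁ := integral_nonneg fun E => add_nonneg (hf0 _ E) (hf0 _ E)
  have hFull : ∫ E, (f t₂ E + f (T - t₂) E) ∂ν = W₁ + W₂ := hcomb t₂ (T - t₂) ht₂0.le hTt₂
  have hW₂eq : W₂ = ∫ E, f t₂ E ∂ν₂ + G₂ := by
    rw [hW₂, integral_add (hfI ν₂ hsupp₂ t₂ ht₂0.le) (hfI ν₂ hsupp₂ _ hTt₂)]
  have hF₂le : F₂ ≤ W₁ + W₂ := by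
    rw [← hFull, hF₂]
    exact integral_mono (hfI ν hsupp t₂ ht₂0.le) (hsumI ν hsupp t₂ (T - t₂) ht₂0.le hTt₂)
      fun E => le_add_of_nonneg_right (hf0 _ E)
  have hf₂ν₂0 : 0 ≤ ∫ E, f t₂ E ∂ν₂ := integral_nonneg fun E => hf0 _ E
  have hG₂le : G₂ ≤ W₁ + W₂ := by rw [hW₂eq]; linarith
  -- the left-hand side, split
  have hLt : ∫ E, (f t E + f (T - t) E) ∂ν = ∫ E, (f t E + f (T - t) E) ∂ν₁ + (∫ E, f t E ∂ν₂ + ∫ E, f (T - t) E ∂ν₂) := by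
    rw [hcomb t (T - t) ht0.le hTt, integral_add (hfI ν₂ hsupp₂ t ht0.le) (hfI ν₂ hsupp₂ _ hTt)]
  -- assemble
  have hK₁ : 0 ≤ A * (1 + Real.exp 4) := by positivity
  have hK₂ : 0 ≤ A ^ 2 * 8 ^ 8 * Real.exp 6 := by positivity
  have ht₂8 : 0 ≤ t₂ ^ 8 := by positivity
  show t ^ 8 * (κ₀ + ∫ E, (f t E + f (T - t) E) ∂ν) ≤
      (A * (1 + Real.exp 4) + A ^ 2 * 8 ^ 8 * Real.exp 6 + 1) * t₂ ^ 8 * (κ₀ + ∫ E, (f t₂ E + f (T - t₂) E) ∂ν)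
  rw [hLt, hFull]
  have e1 : A * (1 + Real.exp 4) * t₂ ^ 8 * (κ₀ + W₁) ≤ A * (1 + Real.exp 4) * t₂ ^ 8 * (κ₀ + (W₁ + W₂)) := by
    have : κ₀ + W₁ ≤ κ₀ + (W₁ + W₂) := by linarith [show 0 ≤ W₂ by rw [hW₂eq]; positivity]
    exact mul_le_mul_of_nonneg_left this (by positivity)
  have e2 : A ^ 2 * 8 ^ 8 * Real.exp 6 * t₂ ^ 8 * F₂ ≤ A ^ 2 * 8 ^ 8 * Real.exp 6 * t₂ ^ 8 * (κ₀ + (W₁ + W₂)) :=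
    mul_le_mul_of_nonneg_left (by linarith) (by positivity)
  have e3 : t₂ ^ 8 * G₂ ≤ 1 * t₂ ^ 8 * (κ₀ + (W₁ + W₂)) := by
    rw [one_mul]; exact mul_le_mul_of_nonneg_left (by linarith) ht₂8
  have lhs : t ^ 8 * (κ₀ + (∫ E, (f t E + f (T - t) E) ∂ν₁ + (∫ E, f t E ∂ν₂ + ∫ E, f (T - t) E ∂ν₂))) =
      t ^ 8 * (κ₀ + ∫ E, (f t E + f (T - t) E) ∂ν₁) + t ^ 8 * ∫ E, f t E ∂ν₂ + t ^ 8 * ∫ E, f (T - t) E ∂ν₂ := by ring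
  rw [lhs]
  have rhs : (A * (1 + Real.exp 4) + A ^ 2 * 8 ^ 8 * Real.exp 6 + 1) * t₂ ^ 8 * (κ₀ + (W₁ + W₂)) =
      A * (1 + Real.exp 4) * t₂ ^ 8 * (κ₀ + (W₁ + W₂)) + A ^ 2 * 8 ^ 8 * Real.exp 6 * t₂ ^ 8 * (κ₀ + (W₁ + W₂)) +
        1 * t₂ ^ 8 * (κ₀ + (W₁ + W₂)) := by ring
  rw [rhs]
  linarith [h1, h2, h3, e1, e2, e3]

end Summit.QuantumFields.YangMills.Cruxes.ScaleMonotonicity.SpectralW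

namespace Summit.QuantumFields.YangMills.Theses.ThermodynamicCeilings

/-- the support item `AbelWindowTransferW` (stmt-QuantumFields-27777) by name, with `A' = A(1+e⁴) + A²·8⁸·e⁶ + 1`. -/
theorem abelWindowTransferW_proof : AbelWindowTransferW := by
  intro A hA
  refine ⟨A * (1 + Real.exp 4) + A ^ 2 * 8 ^ 8 * Real.exp 6 + 1, ?_, ?_⟩
  · have : 0 ≤ A * (1 + Real.exp 4) + A ^ 2 * 8 ^ 8 * Real.exp 6 := by positivity
    linarith
  · intro ν κ₀ E₀ T hfin hsupp hκ₀ hE₀ hE₀1 hwin huv t t₂ ht htt hT hwin4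
    exact Summit.QuantumFields.YangMills.Cruxes.ScaleMonotonicity.SpectralW.abelWindowTransferW_core
      ν κ₀ A E₀ T hfin hsupp hκ₀ hA hE₀ hE₀1 hwin huv t t₂ ht htt hT hwin4

end Summit.QuantumFields.YangMills.Theses.ThermodynamicCeilings
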